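import Summits.QuantumFields.BalabanUV.Beta.GAN24.BornLambdaContactCells
import Summits.QuantumFields.BalabanUV.Beta.GAN24.BornLambdaTent
import Summits.QuantumFields.BalabanUV.Beta.GAN24.AxProjBmWindow
import Summits.QuantumFields.BalabanUV.Beta.GAN24.RespStepConstraint
import Summits.QuantumFields.BalabanUV.Beta.GAN24.RespStepBmGaugeStep
import Summits.QuantumFields.BalabanUV.Beta.ValueHessianBlind

/-!
# `BalabanUV.Beta.GAN24.BornLambdaVertexTent` — binder row G-an2-4 / (CONV-C), CT-ROUTE, `gen20/BORNSEC-PLAN-v1.md` §0 (c1) ∕ (Λ-C)(C2): **THE VERTEX SLOT OF A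
# Λ LINEAGE IS EXACT — the dressed leg chain from the birth level, contour-summed once, is the dressed chain from the next level** (PART 1: the reproduction
# lemmas; PART 2, the tent form of the vertex factor of leaf-01's cells, follows)

NOT IN PRINT; OUR BOOKKEEPING (row owner `b2b-balaban-gan24-p1`, gen 20; [folklore] over tree theorems BY NAME: an2's `AxialProjectorBlockMean.contourSum_axProjBmAt`
(`𝒬 ∘ Π_bm = 𝒬`), leaf-02's `AxProjBmWindow.axProjBmAt_eq_coProjBmW'` (the window operator IS the projector), leaf-03's `RespStepConstraint.contourSum_respStep`
(`𝒬_{Lc} respStep (Lc^m) (Lc^{m+1}) = δ`), leaf-01 g43's `RespStepBm.respStepBm` ∕ `bmW`, leaf-17's `Push4Iter.legChain` ∕ `legDecay_legChain`, leaf-03's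
`SrecWilsonSector.legDecay_respStepBmSeq`, an5's `contourSum_tsum`).  0 `def`, 0 cited facts, 0 `def … : Prop`, 0 sorry; NO estimate.
HONEST FRAMING (cell contract, verbatim): «discharging `BetaPertH` makes Bałaban's UV stability UNCONDITIONAL — a real constructive-QFT result; it is NOT the
continuum limit and NOT the Clay problem.»  HONEST DEPENDENCY (verbatim): «continuum YM on T⁴ ⇐ BetaPertH ∧ nine spine estimates (0/9 proved); BetaPertH ⇐
(D1) ∧ (D4) ∧ CAP+tail; G-an2-4 gates asym, D1 and NE2/3/4.»  Discharges NO slot letter; NEVER «G-an2-4 closed»; NOT D1, NOT `BetaPertH`, NOT continuum, NOT Clay.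

## What (generic `d`; in-block root `ρ = toSite rr`, `rr ∈ box (d+1) Lc`)
* **`contourSum_respStepBmSeq`**: `contourSum Lc (respStepBmSeq ρ Lc m μ z) l w = [w = z ∧ l = μ]` — the DRESSED one-step response reproduces the constraint exactly like
  the undressed one (`𝒬 ∘ Π_bm = 𝒬` + `contourSum_respStep`).
* **`contourSum_legChain_respStepBmSeq`**: `contourSum Lc (legChain (respStepBmSeq ρ Lc) m (n+1) μ y) l w = legChain (respStepBmSeq ρ Lc) (m+1) n μ y l w` — ONE
  contour sum on the fine index of the dressed chain from level `m` is the dressed chain from level `m+1` (induction on `n`; the exchange of the finite contour sum with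
  the composition series by the legs' localisation).
USE ((C2)): the vertex slot of every Λ lineage pairs the chain `T_i = legChain … i (k−1−i)` with the `𝒬ᵀ_{Lc}`-tent coefficient of `BornLambdaTent` — by adjointness
the chain is contour-summed once, so the vertex factor reads the chain FROM LEVEL `i+1` against the unit multiplier kernel `Ê_{i+1}`; no contact cell arises there.
Unit `b2b-balaban-gan24-p1` (row owner G-an2-4, gen 20), 2026-08-21.
-/

noncomputable section

open Finset
open scoped BigOperators
open Literature.MathematicalPhysics.QuantumFieldTheory
open Literature.MathematicalPhysics.QuantumFieldTheory.Balaban1983to89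
open Literature.MathematicalPhysics.QuantumFieldTheory.Balaban1983to89.Beta
open B12Sec2to5 (l1)
open AffineAveraging (Form1 Site box toSite contourSum)
open BalabanCompositeJets (respStep)
open ResolventComposition (contourSum_tsum)
open KKTFluctuationEnergy (lip1 lip1_contourSumAdj summable_of_exp_bound summable_mul_of_bdd')
open AffineReproduction (contourSumAdj)
open Summit.QuantumFields.BalabanUV.Beta.AxialProjectorBlockMean (contourSum_axProjBmAt)
open Summit.QuantumFields.BalabanUV.Beta.AxialDressingRooted (one_le_of_neZero)
open Summit.QuantumFields.BalabanUV.Beta.GAN24.AxProjBmWindow (axProjBmAt_eq_coProjBmW')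
open Summit.QuantumFields.BalabanUV.Beta.GAN24.Push4 (legComp legComp_apply)
open Summit.QuantumFields.BalabanUV.Beta.GAN24.Push4Bounds (LegDecay)
open Summit.QuantumFields.BalabanUV.Beta.GAN24.Push4Iter (LegFam legChain legChain_zero legChain_succ legDecay_legChain)
open Summit.QuantumFields.BalabanUV.Beta.GAN24.RespStepBm (respStepBm bmW)
open Summit.QuantumFields.BalabanUV.Beta.GAN24.RespStepBmDecompExact (respStepBmSeq respStepBmSeq_apply)
open Summit.QuantumFields.BalabanUV.Beta.GAN24.RespStepConstraint (contourSum_respStep)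
open Summit.QuantumFields.BalabanUV.Beta.GAN24.SrecWilsonSector (legDecay_respStepBmSeq)
open Summit.QuantumFields.BalabanUV.Beta.GAN24.BornLambdaLineage (legChain_sub_respStep_of_lt)
open Summit.QuantumFields.BalabanUV.Beta.GAN24.RespStepBmDecompPsi (Psi)
open Summit.QuantumFields.BalabanUV.Beta.AxialProjectorBlockMean (bmGaugeAt)
open Summit.QuantumFields.BalabanUV.Beta.BorderedHessian (codiff₁_wΦ_shift)
open Summit.QuantumFields.BalabanUV.Beta.GAN24.RespStepBmGaugeStep (exists_abs_respStep_le)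
open Summit.QuantumFields.BalabanUV.Beta.GAN24.RespStepEffectiveEL (wΦ_pair_respStep)
open KernelSpecInstance (wΦ)

namespace Summit.QuantumFields.BalabanUV.Beta.GAN24.BornLambdaVertexTent

variable {d Lc : ℕ} [NeZero Lc]

/-- NOT IN PRINT; OUR BOOKKEEPING ([folklore]).  **THE DRESSED ONE-STEP RESPONSE REPRODUCES THE CONSTRAINT**: for an in-block root and every level `m`,
`contourSum Lc (respStepBmSeq ρ Lc m μ z) l w = [w = z ∧ l = μ]` — the dressing is `Π_bm` of the undressed column (`bmW = coProjBmW = axProjBmAt`), `𝒬 ∘ Π_bm = 𝒬`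
(an2), and the undressed leg reproduces the constraint (`contourSum_respStep`). -/
theorem contourSum_respStepBmSeq {rr : Fin (d + 1) → ℕ} (hrr : rr ∈ box (d + 1) Lc) (m : ℕ) (μ : Fin (d + 1)) (z : Site (d + 1))
    (l : Fin (d + 1)) (w : Site (d + 1)) :
    contourSum Lc (respStepBmSeq (d := d) (toSite rr) Lc m μ z) l w = if w = z ∧ l = μ then 1 else 0 := by
  have hL : 1 ≤ Lc := one_le_of_neZero Lc
  rw [respStepBmSeq_apply]
  show contourSum Lc (bmW (toSite rr) Lc (respStep (d := d) (Lc ^ m) (Lc ^ (m + 1))) μ z) l w = _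
  have e : bmW (toSite rr) Lc (respStep (d := d) (Lc ^ m) (Lc ^ (m + 1))) μ z
      = AxialProjectorBlockMean.axProjBmAt (toSite rr) Lc (respStep (d := d) (Lc ^ m) (Lc ^ (m + 1)) μ z) := by
    funext κ u
    rw [axProjBmAt_eq_coProjBmW' hL hrr]
    rfl
  rw [e, contourSum_axProjBmAt (toSite rr) hL, contourSum_respStep]

/-- [folklore] The middle-variable series of a leg composition with a localised first factor and a bounded second factor is summable. -/
theorem summable_leg_mul {r : LegFam d} {N : ℕ} {C m : ℝ} (hr : LegDecay r N C m) (hm : 0 < m) (μ : Fin (d + 1)) (y : Site (d + 1))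
    (lam : Fin (d + 1)) {g : Site (d + 1) → ℝ} {B : ℝ} (hg : ∀ v, |g v| ≤ B) :
    Summable fun v : Site (d + 1) => r μ y lam v * g v :=
  summable_mul_of_bdd' (summable_of_exp_bound hm ((N : ℤ) • y) (fun v => hr μ y lam v)) hg

/-- [folklore] One contour sum of a finite superposition of leg columns with scalar weights: the weights come out. -/
theorem contourSum_sum_mul (L : ℕ) (a : Fin (d + 1) → ℝ) (R : Fin (d + 1) → Form1 (d + 1) ℝ) (l : Fin (d + 1)) (w : Site (d + 1)) :
    contourSum L (fun κ u => ∑ lam : Fin (d + 1), a lam * R lam κ u) l w = ∑ lam : Fin (d + 1), a lam * contourSum L (R lam) l w := by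
  simp only [contourSum, Finset.mul_sum]
  calc ∑ b ∈ box (d + 1) L, ∑ t ∈ Finset.range L, ∑ lam : Fin (d + 1),
          a lam * R lam l ((L : ℤ) • w + toSite b + (t : ℤ) • AffineAveraging.unitVec l)
      = ∑ b ∈ box (d + 1) L, ∑ lam : Fin (d + 1), ∑ t ∈ Finset.range L,
          a lam * R lam l ((L : ℤ) • w + toSite b + (t : ℤ) • AffineAveraging.unitVec l) :=
        Finset.sum_congr rfl fun b _ => Finset.sum_comm
    _ = ∑ lam : Fin (d + 1), ∑ b ∈ box (d + 1) L, ∑ t ∈ Finset.range L,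
          a lam * R lam l ((L : ℤ) • w + toSite b + (t : ℤ) • AffineAveraging.unitVec l) := Finset.sum_comm

/-- NOT IN PRINT; OUR BOOKKEEPING ([folklore]).  **ONE CONTOUR SUM ON THE FINE INDEX OF THE DRESSED CHAIN FROM LEVEL `m` IS THE DRESSED CHAIN FROM LEVEL `m+1`**:
`contourSum Lc (legChain (respStepBmSeq ρ Lc) m (n+1) μ y) l w = legChain (respStepBmSeq ρ Lc) (m+1) n μ y l w` (in-block root; induction on `n`: the finite
contour sum passes the composition series by the legs' localisation, and acts on the finest factor by `contourSum_respStepBmSeq`). -/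
theorem contourSum_legChain_respStepBmSeq {rr : Fin (d + 1) → ℕ} (hrr : rr ∈ box (d + 1) Lc) (m : ℕ) :
    ∀ (n : ℕ) (μ : Fin (d + 1)) (y : Site (d + 1)) (l : Fin (d + 1)) (w : Site (d + 1)),
      contourSum Lc (legChain (respStepBmSeq (d := d) (toSite rr) Lc) m (n + 1) μ y) l w
        = legChain (respStepBmSeq (d := d) (toSite rr) Lc) (m + 1) n μ y l w
  | 0, μ, y, l, w => by
    -- `legChain l m 1 = legComp (l m) (l (m+1))`: contour-sum the finest factor `l m` to a Kronecker datum
    obtain ⟨C₁, m₁, hm₁, h₁⟩ := legDecay_respStepBmSeq (d := d) (Lc := Lc) hrr (m + 1)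
    obtain ⟨C₀, m₀, hm₀, h₀⟩ := legDecay_respStepBmSeq (d := d) (Lc := Lc) hrr m
    rw [legChain_succ _ m 0, legChain_zero, legChain_zero]
    have e : legComp (respStepBmSeq (d := d) (toSite rr) Lc m) (respStepBmSeq (d := d) (toSite rr) Lc (m + 0 + 1)) μ y
        = fun κ u => ∑' v : Site (d + 1), (fun v κ u => ∑ lam : Fin (d + 1),
            respStepBmSeq (d := d) (toSite rr) Lc (m + 1) μ y lam v * respStepBmSeq (d := d) (toSite rr) Lc m lam v κ u) v κ u := by
      funext κ u; rfl
    rw [e, contourSum_tsum _ (fun κ u => summable_sum fun lam _ =>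
      summable_leg_mul h₁ hm₁ μ y lam (fun v => h₀.abs_le hm₀.le lam v κ u))]
    have step : ∀ v, contourSum Lc ((fun v κ u => ∑ lam : Fin (d + 1),
          respStepBmSeq (d := d) (toSite rr) Lc (m + 1) μ y lam v * respStepBmSeq (d := d) (toSite rr) Lc m lam v κ u) v) l w
        = ∑ lam : Fin (d + 1), respStepBmSeq (d := d) (toSite rr) Lc (m + 1) μ y lam v * (if w = v ∧ l = lam then (1 : ℝ) else 0) := by
      intro v
      rw [contourSum_sum_mul Lc (fun lam => respStepBmSeq (d := d) (toSite rr) Lc (m + 1) μ y lam v)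
        (fun lam => respStepBmSeq (d := d) (toSite rr) Lc m lam v) l w]
      exact Finset.sum_congr rfl fun lam _ => by rw [contourSum_respStepBmSeq hrr]
    rw [tsum_congr step, tsum_eq_single w (fun v hv => Finset.sum_eq_zero fun lam _ => by
      rw [if_neg (fun h => hv h.1.symm), mul_zero])]
    rw [Finset.sum_eq_single l (fun lam _ hl => by rw [if_neg (fun h => hl h.2.symm), mul_zero])
      (fun h => (h (Finset.mem_univ l)).elim), if_pos ⟨rfl, rfl⟩, mul_one]
  | n + 1, μ, y, l, w => by
    obtain ⟨C₁, m₁, hm₁, h₁⟩ := legDecay_respStepBmSeq (d := d) (Lc := Lc) hrr (m + (n + 1) + 1)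
    obtain ⟨C₀, m₀, hm₀, h₀⟩ := legDecay_legChain (N := Lc) (fun j => legDecay_respStepBmSeq (d := d) (Lc := Lc) hrr j) m (n + 1)
    rw [legChain_succ _ m (n + 1), legChain_succ _ (m + 1) n, show m + 1 + n + 1 = m + (n + 1) + 1 by ring]
    have e : legComp (legChain (respStepBmSeq (d := d) (toSite rr) Lc) m (n + 1)) (respStepBmSeq (d := d) (toSite rr) Lc (m + (n + 1) + 1)) μ y
        = fun κ u => ∑' v : Site (d + 1), (fun v κ u => ∑ lam : Fin (d + 1),
            respStepBmSeq (d := d) (toSite rr) Lc (m + (n + 1) + 1) μ y lam v *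
              legChain (respStepBmSeq (d := d) (toSite rr) Lc) m (n + 1) lam v κ u) v κ u := by
      funext κ u; rfl
    rw [e, contourSum_tsum _ (fun κ u => summable_sum fun lam _ =>
      summable_leg_mul h₁ hm₁ μ y lam (fun v => h₀.abs_le hm₀.le lam v κ u))]
    have step : ∀ v, contourSum Lc ((fun v κ u => ∑ lam : Fin (d + 1),
          respStepBmSeq (d := d) (toSite rr) Lc (m + (n + 1) + 1) μ y lam v *
            legChain (respStepBmSeq (d := d) (toSite rr) Lc) m (n + 1) lam v κ u) v) l w
        = ∑ lam : Fin (d + 1), respStepBmSeq (d := d) (toSite rr) Lc (m + (n + 1) + 1) μ y lam v *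
            legChain (respStepBmSeq (d := d) (toSite rr) Lc) (m + 1) n lam v l w := by
      intro v
      rw [contourSum_sum_mul Lc (fun lam => respStepBmSeq (d := d) (toSite rr) Lc (m + (n + 1) + 1) μ y lam v)
        (fun lam => legChain (respStepBmSeq (d := d) (toSite rr) Lc) m (n + 1) lam v) l w]
      exact Finset.sum_congr rfl fun lam _ => by rw [contourSum_legChain_respStepBmSeq hrr m n]
    rw [tsum_congr step]
    rfl

/-! ## §2 The vertex pairing: the dressed chain against a `𝒬ᵀ`-tent coefficient reads the chain from the next level -/

/-- NOT IN PRINT; OUR BOOKKEEPING ([folklore]).  **ONE STEP**: the dressed ONE-STEP response paired in its fine index with the contour-sum adjoint of a bounded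
coarse 1-form evaluates that form: `∑'_u ∑_κ respStepBmSeq ρ Lc i κ′ u′ κ u · (𝒬ᵀ_{Lc} φ) κ u = φ κ′ u′` (adjointness `lip1_contourSumAdj` + `contourSum_respStepBmSeq`). -/
theorem tsum_respStepBmSeq_mul_contourSumAdj {rr : Fin (d + 1) → ℕ} (hrr : rr ∈ box (d + 1) Lc) (i : ℕ) {φ : Form1 (d + 1) ℝ} {B : ℝ}
    (hφ : ∀ κ y, |φ κ y| ≤ B) (κ' : Fin (d + 1)) (u' : Site (d + 1)) :
    ∑' u : Site (d + 1), ∑ κ : Fin (d + 1), respStepBmSeq (d := d) (toSite rr) Lc i κ' u' κ u * contourSumAdj Lc φ κ u = φ κ' u' := by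
  obtain ⟨C, m, hm, h⟩ := legDecay_respStepBmSeq (d := d) (Lc := Lc) hrr i
  have hA : ∀ κ, Summable (fun u : Site (d + 1) => respStepBmSeq (d := d) (toSite rr) Lc i κ' u' κ u) :=
    fun κ => summable_of_exp_bound hm ((Lc : ℤ) • u') (fun u => h κ' u' κ u)
  have h1 := lip1_contourSumAdj (N := Lc) (A := fun κ u => respStepBmSeq (d := d) (toSite rr) Lc i κ' u' κ u) hA hφ
  unfold KKTFluctuationEnergy.lip1 at h1
  rw [h1]
  have e : ∀ y : Site (d + 1), (∑ κ : Fin (d + 1), φ κ y *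
      contourSum Lc (fun κ u => respStepBmSeq (d := d) (toSite rr) Lc i κ' u' κ u) κ y)
      = if y = u' then φ κ' u' else 0 := by
    intro y
    have ec : ∀ κ, contourSum Lc (fun κ u => respStepBmSeq (d := d) (toSite rr) Lc i κ' u' κ u) κ y
        = if y = u' ∧ κ = κ' then (1 : ℝ) else 0 := fun κ => contourSum_respStepBmSeq hrr i κ' u' κ y
    simp only [ec]
    by_cases hy : y = u'
    · subst hy
      rw [if_pos rfl, Finset.sum_eq_single κ' (fun κ _ hκ => by rw [if_neg (fun h => hκ h.2), mul_zero])
        (fun h => (h (Finset.mem_univ κ')).elim), if_pos ⟨rfl, rfl⟩, mul_one]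
    · rw [if_neg hy]
      exact Finset.sum_eq_zero fun κ _ => by rw [if_neg (fun h => hy h.1), mul_zero]
  rw [tsum_congr e, tsum_eq_single u' (fun y hy => if_neg hy), if_pos rfl]

/-- NOT IN PRINT; OUR BOOKKEEPING ([folklore]).  **THE CHAIN**: the dressed chain from level `i` of `n+2` steps, paired in its fine index with the contour-sum
adjoint of a bounded level-(i+1) 1-form, is that form paired with the dressed chain FROM LEVEL `i+1`:
`∑'_u ∑_κ legChain (respStepBmSeq ρ Lc) i (n+1) κ′ u′ κ u · (𝒬ᵀ_{Lc} φ) κ u = ∑'_{y₁} ∑_{κ₁} φ κ₁ y₁ · legChain (respStepBmSeq ρ Lc) (i+1) n κ′ u′ κ₁ y₁`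
(`lip1_contourSumAdj` + `contourSum_legChain_respStepBmSeq`).  With `BornLambdaTent` (the born Λ-coefficients are `(−cΛ)·𝒬ᵀ_{Lc}[Ê_{i+1}(·; μ, · − y)]`) this is
BORNSEC-PLAN v1 §0 (c1): the VERTEX FACTOR of every Λ lineage reads the chain from the NEXT level against the unit multiplier kernel — the dressing of the level-`i` leg
never enters the vertex slot. -/
theorem tsum_legChain_mul_contourSumAdj {rr : Fin (d + 1) → ℕ} (hrr : rr ∈ box (d + 1) Lc) (i n : ℕ) {φ : Form1 (d + 1) ℝ} {B : ℝ}
    (hφ : ∀ κ y, |φ κ y| ≤ B) (κ' : Fin (d + 1)) (u' : Site (d + 1)) :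
    ∑' u : Site (d + 1), ∑ κ : Fin (d + 1), legChain (respStepBmSeq (d := d) (toSite rr) Lc) i (n + 1) κ' u' κ u * contourSumAdj Lc φ κ u
      = ∑' y₁ : Site (d + 1), ∑ κ₁ : Fin (d + 1), φ κ₁ y₁ * legChain (respStepBmSeq (d := d) (toSite rr) Lc) (i + 1) n κ' u' κ₁ y₁ := by
  obtain ⟨C, m, hm, h⟩ := legDecay_legChain (N := Lc) (fun j => legDecay_respStepBmSeq (d := d) (Lc := Lc) hrr j) i (n + 1)
  have hA : ∀ κ, Summable (fun u : Site (d + 1) => legChain (respStepBmSeq (d := d) (toSite rr) Lc) i (n + 1) κ' u' κ u) :=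
    fun κ => summable_of_exp_bound hm (((Lc ^ (n + 1 + 1) : ℕ) : ℤ) • u') (fun u => h κ' u' κ u)
  have h1 := lip1_contourSumAdj (N := Lc) (A := fun κ u => legChain (respStepBmSeq (d := d) (toSite rr) Lc) i (n + 1) κ' u' κ u) hA hφ
  unfold KKTFluctuationEnergy.lip1 at h1
  rw [h1]
  refine tsum_congr fun y₁ => Finset.sum_congr rfl fun κ₁ _ => ?_
  rw [contourSum_legChain_respStepBmSeq hrr i n κ' u' κ₁ y₁]

/-! ## §3 The unit multiplier kernel kills the chain's pure gauge; the undressed remainder is the E2-tent (PART 2) -/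

section Tent

/-- [folklore] A translated column of the multiplier kernel is summable in each direction (an2∕an5's exponential decay `decay_wΦ`). -/
theorem summable_wΦ_shift {N : ℕ} [NeZero N] (μ : Fin (d + 1)) (y : Site (d + 1)) (κ : Fin (d + 1)) :
    Summable (fun y₁ : Site (d + 1) => wΦ (N := N) (d := d) κ μ (y₁ - y)) := by
  obtain ⟨δ, C, hδ, h⟩ := KernelSpecInstance.decay_wΦ (N := N) (d := d)
  exact KKTFluctuationEnergy.summable_shift_sub (DecimatedMomentLimit.summable_of_decay510 hδ (h κ μ)) y

/-- NOT IN PRINT; OUR BOOKKEEPING ([folklore]).  **THE MULTIPLIER KERNEL KILLS PURE GAUGES IN ITS PAIRED SLOT**: for every BOUNDED `ψ`,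
`∑'_{y₁} ∑_{κ₁} wΦ_N κ₁ μ (y₁ − y) · dz ψ κ₁ y₁ = 0` — summation by parts (`lip0_codiff₁`) onto d1's first-slot co-closedness `codiff₁_wΦ_shift`
(the value Hessian is blind to pure gauges).  No summability of `ψ` is needed (the dressing's gauge functions are bounded, not summable). -/
theorem tsum_wΦ_shift_mul_dz_eq_zero {N : ℕ} [NeZero N] (μ : Fin (d + 1)) (y : Site (d + 1)) {ψ : AffineAveraging.Form0 (d + 1) ℝ} {M : ℝ}
    (hψ : ∀ x, |ψ x| ≤ M) :
    ∑' y₁ : Site (d + 1), ∑ κ₁ : Fin (d + 1), wΦ (N := N) (d := d) κ₁ μ (y₁ - y) * AffineAveraging.dz ψ κ₁ y₁ = 0 := by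
  have h := KKTFluctuationEnergy.lip0_codiff₁ (B := fun κ₁ y₁ => wΦ (N := N) (d := d) κ₁ μ (y₁ - y)) hψ (summable_wΦ_shift μ y)
  rw [codiff₁_wΦ_shift (N := N) μ y] at h
  have h0 : KKTFluctuationEnergy.lip0 ψ (0 : AffineAveraging.Form0 (d + 1) ℝ) = 0 := by
    simp [KKTFluctuationEnergy.lip0]
  rw [h0] at h
  unfold KKTFluctuationEnergy.lip1 at h
  refine Eq.trans ?_ h.symm
  exact tsum_congr fun y₁ => Finset.sum_congr rfl fun κ₁ _ => mul_comm _ _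

/-- NOT IN PRINT; OUR BOOKKEEPING ([folklore]; BORNSEC-PLAN v1 §0 (c1), PART 2).  **THE VERTEX FACTOR IS THE E2-TENT**: for an in-block root, a birth level `i`, a chain of
`n+1` dressed steps from level `i+1` (observation level `k = i+n+2`), with the pure-gauge defect `ψ` of that chain against the undressed one-shot response
(leaf-01's `legChain_sub_respStep_of_lt`) BOUNDED — hypothesis `hψ`, discharged at `d = 3` by leaf-01 g57's `DressedLegUnits.exists_abs_gauge_le`:
`∑'_{y₁} ∑_{κ₁} wΦ_{Lc^{i+1}} κ₁ μ (y₁ − y) · legChain (respStepBmSeq ρ Lc) (i+1) n κ′ u′ κ₁ y₁ = contourSumAdj (Lc^{n+1}) (fun κ q ↦ wΦ_{Lc^{i+n+2}} κ κ′ (q − u′)) μ y`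
— the level-(i+1) multiplier kernel paired with the DRESSED chain from level `i+1` IS the `Lc^{n+1}`-CONTOUR TENT of the level-`k` multiplier column: the dressing
drops out (`tsum_wΦ_shift_mul_dz_eq_zero`) and the undressed remainder is the owner's `RespStepEffectiveEL.wΦ_pair_respStep` at base `M = Lc^{i+1}`.  With §2 and
`BornLambdaTent`: the vertex factor of every Λ contact cell of `BornLambdaContactCells` is `(−cΛ)·(unit scalar)·(this tent)` — the Maxwell-letter-size partner at every base. -/
theorem tsum_wΦ_shift_mul_legChain_eq_tent {rr : Fin (d + 1) → ℕ} (hrr : rr ∈ box (d + 1) Lc) (i n : ℕ) (μ : Fin (d + 1)) (y : Site (d + 1))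
    (κ' : Fin (d + 1)) (u' : Site (d + 1)) {M : ℝ}
    (hψ : ∀ x, |(Psi (toSite rr) Lc (i + 1) n (KKTFluctuationKernel.delta1 κ' u')
        - bmGaugeAt (toSite rr) (respStep (d := d) (Lc ^ (i + 1)) (Lc ^ (i + n + 2)) κ' u') Lc) x| ≤ M) :
    ∑' y₁ : Site (d + 1), ∑ κ₁ : Fin (d + 1),
        wΦ (N := Lc ^ (i + 1)) (d := d) κ₁ μ (y₁ - y) * legChain (respStepBmSeq (d := d) (toSite rr) Lc) (i + 1) n κ' u' κ₁ y₁
      = contourSumAdj (Lc ^ (n + 1)) (fun κ q => wΦ (N := Lc ^ (i + n + 2)) (d := d) κ κ' (q - u')) μ y := by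
  set ψ : AffineAveraging.Form0 (d + 1) ℝ := Psi (toSite rr) Lc (i + 1) n (KKTFluctuationKernel.delta1 κ' u')
      - bmGaugeAt (toSite rr) (respStep (d := d) (Lc ^ (i + 1)) (Lc ^ (i + n + 2)) κ' u') Lc with hψdef
  -- split the dressed chain: one-shot response + pure gauge
  have hlt : i + 1 < i + n + 2 := by omega
  have hsub := legChain_sub_respStep_of_lt (d := d) (Lc := Lc) hrr hlt
  have hn : i + n + 2 - 1 - (i + 1) = n := by omega
  rw [hn] at hsub
  have e : ∀ y₁ κ₁, legChain (respStepBmSeq (d := d) (toSite rr) Lc) (i + 1) n κ' u' κ₁ y₁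
      = respStep (d := d) (Lc ^ (i + 1)) (Lc ^ (i + n + 2)) κ' u' κ₁ y₁ + AffineAveraging.dz ψ κ₁ y₁ := by
    intro y₁ κ₁
    have := congrFun (congrFun (congrFun (congrFun hsub κ') u') κ₁) y₁
    simp only [Pi.sub_apply] at this
    rw [hψdef]
    linarith
  simp only [e, mul_add, Finset.sum_add_distrib]
  -- summability of the two pieces (wΦ-column summable × bounded)
  obtain ⟨C, hC⟩ := exists_abs_respStep_le (d := d) (N' := Lc ^ (i + n + 2)) (Lc ^ (i + 1))
  have hM : 0 ≤ M := (abs_nonneg _).trans (hψ 0)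
  have s1 : Summable fun y₁ : Site (d + 1) => ∑ κ₁ : Fin (d + 1),
      wΦ (N := Lc ^ (i + 1)) (d := d) κ₁ μ (y₁ - y) * respStep (d := d) (Lc ^ (i + 1)) (Lc ^ (i + n + 2)) κ' u' κ₁ y₁ :=
    summable_sum fun κ₁ _ => summable_mul_of_bdd' (summable_wΦ_shift μ y κ₁) (fun y₁ => hC κ' u' κ₁ y₁)
  have s2 : Summable fun y₁ : Site (d + 1) => ∑ κ₁ : Fin (d + 1),
      wΦ (N := Lc ^ (i + 1)) (d := d) κ₁ μ (y₁ - y) * AffineAveraging.dz ψ κ₁ y₁ :=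
    summable_sum fun κ₁ _ => summable_mul_of_bdd' (summable_wΦ_shift μ y κ₁) (fun y₁ => KKTFluctuationEnergy.abs_dz_le hψ κ₁ y₁)
  rw [Summable.tsum_add s1 s2, tsum_wΦ_shift_mul_dz_eq_zero μ y hψ, add_zero]
  exact wΦ_pair_respStep (d := d) (M := Lc ^ (i + 1)) (L := Lc ^ (n + 1)) (N' := Lc ^ (i + n + 2))
    (by ring) κ' u' μ y

/-- NOT IN PRINT; OUR BOOKKEEPING ([folklore]).  **`d = 3`, NO hypothesis on the gauge** (`2 ≤ Lc`, in-block root): the vertex factor is the E2-tent — leaf-01 g59's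
`BornLambdaContactCells.exists_abs_lineageGauge_le` (leaf-01 g57's `exists_abs_gauge_le` at the point datum) discharges `hψ`. -/
theorem tsum_wΦ_shift_mul_legChain_eq_tent_three {Lc : ℕ} [NeZero Lc] (hLc : 2 ≤ Lc) {rr : Fin (3 + 1) → ℕ} (hrr : rr ∈ box (3 + 1) Lc)
    (i n : ℕ) (μ : Fin (3 + 1)) (y : Site (3 + 1)) (κ' : Fin (3 + 1)) (u' : Site (3 + 1)) :
    ∑' y₁ : Site (3 + 1), ∑ κ₁ : Fin (3 + 1),
        wΦ (N := Lc ^ (i + 1)) (d := 3) κ₁ μ (y₁ - y) * legChain (respStepBmSeq (d := 3) (toSite rr) Lc) (i + 1) n κ' u' κ₁ y₁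
      = contourSumAdj (Lc ^ (n + 1)) (fun κ q => wΦ (N := Lc ^ (i + n + 2)) (d := 3) κ κ' (q - u')) μ y := by
  obtain ⟨K, -, hK⟩ := BornLambdaContactCells.exists_abs_lineageGauge_le (Lc := Lc) hLc
  have h := hK rr hrr (i + 1) n κ' u'
  rw [show i + 1 + n + 1 = i + n + 2 by ring] at h
  exact tsum_wΦ_shift_mul_legChain_eq_tent hrr i n μ y κ' u' (M := K * ((Lc : ℝ) ^ (4 * (n + 1)))⁻¹) h

end Tent

end Summit.QuantumFields.BalabanUV.Beta.GAN24.BornLambdaVertexTent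

end
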